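import Summits.CriticalPhenomena.PercolationContinuityZ3.Theorems.PercNearOneGluingNoHeavyLowerTailSahiCombMixFourSingleOne

/-!
# The comb (tensor-Bernstein) hierarchy for Sahi's `E_k`, XLI: comb H-MIX(4) — the singleton four-slot cell with ALL FOUR events mixed (`|G| = 4`, TOP(4))

Support file of the one-cut programme (crux `NoHeavyLowerTail`, stmt-CriticalPhenomena-4575; cell `prim-masterthm`, seat P3, gen 8; HIERARCHY.md §15(d),(i)).
The fourth class of `SahiCombMix.CombFourSingletonCells`: the coordinate `e` OR-ed into all four events.  Cube version of gen 6's TOP(4) DEFECT FORM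
(`SahiMixture.sahiE_four_orCoin_top_eq`): `E_4(U_j ∪ [e]) = p(1−p)T₁ + (1−p)²E_4(U) + p(1−p)²N₃ + p(1−p)²(2−p)N₄` (`p = p_e`) with `T₁ = 2μ(at most two of the U_j)`,
`N₃ = ½Σ_l Π_{r≠l} μ(Ū_r) + ½Σ_{i≠l} μ(U_i∖U_l) Π_{r∉{i,l}} μ(Ū_r)`, `N₄ = Π μ(Ū_i)`; degree-4 Bernstein coefficients `E_4`, `T₁ + 2E_4 + N₃ + 2N₄`, `2T₁ + E_4 + N₃ + N₄`,
`T₁`, `0` — comb-positive off `e` (one hereditary comb row, the rest products of comb-positive defect moments).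
* `combPos_co`, `combPos_diff`, `combPos_diff'`, `combPos_atMostTwo` — the defect moments; `deg22`.
* **`combPos_fourSlot_G4`** — the cell for `G = (true, true, true, true)`. [this work]
-/

noncomputable section

open scoped Classical

namespace Summit.CriticalPhenomena.PercolationContinuityZ3.Theorems

open Finset Function
open Literature.Combinatorics.Sahi2008
open Literature.Probability.Percolation.BHK2006 (ind_le_one ind_inter)
open Literature.Probability.Percolation.DecisionTree (ind ind_of_mem ind_of_not_mem ind_nonneg)
open SahiComb
open SahiCombDisjunct (orCoord)
open SahiCombHereditary (CombHereditary)

variable {ι : Type} [Fintype ι]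

namespace SahiCombMix

omit [Fintype ι] in
/-- `(2 off e) + (2 off e) = (4 off e)`. [folklore] -/
theorem deg22 (e : ι) : update (fun _ : ι => (2 : ℕ)) e 0 + update (fun _ : ι => (2 : ℕ)) e 0 = update (fun _ : ι => 4) e 0 := by
  funext x; by_cases hx : x = e
  · subst hx; simp
  · simp [hx]

section Defects

variable (U : Fin 4 → Set (Set ι)) (e : ι) (hUe : ∀ (j : Fin 4) (b : Bool), secAt e b (U j) = U j)
include hUe

/-- `μ_p(Ū_r) = 1 − μ_p(U_r)` is comb-positive at multidegree `1` off `e`. [this work] -/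
theorem combPos_co (r : Fin 4) : CombPos (update (fun _ : ι => 1) e 0) (fun p => 1 - ex (bernoulliWeight p) (ind (U r))) := by
  have h0 := (combPos_ex (ι := ι) (h := fun ω => 1 - ind (U r) ω) fun ω => sub_nonneg.2 (ind_le_one (U r) ω)).of_ignores e
    fun p s => SahiCombDisjunct.ex_update_of_ignores' e (fun ω => by
      show 1 - ind (U r) (insert e ω) = 1 - ind (U r) ω
      rw [ind_U4_insert U e hUe]) p s
  refine h0.congr fun p => ?_
  have ee := SahiMixture.ex_eq_lin (bernoulliWeight p) (fun ω => 1 - ind (U r) ω) ![1, -1] ![fun _ => 1, ind (U r)]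
    (fun ω => by simp [Fin.sum_univ_succ]; ring)
  simp only [Fin.sum_univ_succ, Fin.sum_univ_zero, Matrix.cons_val_zero, Matrix.cons_val_succ, ex_const (sum_bernoulliWeight p)] at ee
  rw [ee]; ring

/-- `μ_p(U_i ∖ U_l) = μ_p(U_i) − μ_p(U_i ∩ U_l)` (product written `1_{U_i}1_{U_l}`) is comb-positive at multidegree `1` off `e`. [this work] -/
theorem combPos_diff (i l : Fin 4) :
    CombPos (update (fun _ : ι => 1) e 0) (fun p => ex (bernoulliWeight p) (ind (U i)) - ex (bernoulliWeight p) (ind (U i) * ind (U l))) := by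
  have h0 := (combPos_ex (ι := ι) (h := fun ω => ind (U i) ω * (1 - ind (U l) ω)) fun ω =>
      mul_nonneg (ind_nonneg (U i) ω) (sub_nonneg.2 (ind_le_one (U l) ω))).of_ignores e
    fun p s => SahiCombDisjunct.ex_update_of_ignores' e (fun ω => by
      show ind (U i) (insert e ω) * (1 - ind (U l) (insert e ω)) = ind (U i) ω * (1 - ind (U l) ω)
      rw [ind_U4_insert U e hUe, ind_U4_insert U e hUe]) p s
  refine h0.congr fun p => ?_
  have ee := SahiMixture.ex_eq_lin (bernoulliWeight p) (fun ω => ind (U i) ω * (1 - ind (U l) ω)) ![1, -1] ![ind (U i), ind (U i) * ind (U l)]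
    (fun ω => by simp [Fin.sum_univ_succ]; ring)
  simp only [Fin.sum_univ_succ, Fin.sum_univ_zero, Matrix.cons_val_zero, Matrix.cons_val_succ] at ee
  rw [ee]; ring

/-- The same with the product written `1_{U_l}1_{U_i}`. [this work] -/
theorem combPos_diff' (i l : Fin 4) :
    CombPos (update (fun _ : ι => 1) e 0) (fun p => ex (bernoulliWeight p) (ind (U i)) - ex (bernoulliWeight p) (ind (U l) * ind (U i))) := by
  have hc : ind (U l) * ind (U i) = ind (U i) * ind (U l) := mul_comm _ _
  rw [hc]; exact combPos_diff U e hUe i l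

/-- `μ_p(at most two of U_0..U_3) = 1 − Σ_{|S|=3} μ_p(U_S) + 3μ_p(U_{0123})` is comb-positive at multidegree `1` off `e`. [this work] -/
theorem combPos_atMostTwo :
    CombPos (update (fun _ : ι => 1) e 0) (fun p => 1 - (ex (bernoulliWeight p) (ind (U 1) * ind (U 2) * ind (U 3))
      + ex (bernoulliWeight p) (ind (U 0) * ind (U 2) * ind (U 3)) + ex (bernoulliWeight p) (ind (U 0) * ind (U 1) * ind (U 3))
      + ex (bernoulliWeight p) (ind (U 0) * ind (U 1) * ind (U 2))) + 3 * ex (bernoulliWeight p) (ind (U 0) * ind (U 1) * ind (U 2) * ind (U 3))) := by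
  have hnn : ∀ ω : Set ι, 0 ≤ 1 - (ind (U 1) ω * ind (U 2) ω * ind (U 3) ω + ind (U 0) ω * ind (U 2) ω * ind (U 3) ω
      + ind (U 0) ω * ind (U 1) ω * ind (U 3) ω + ind (U 0) ω * ind (U 1) ω * ind (U 2) ω)
      + 3 * (ind (U 0) ω * ind (U 1) ω * ind (U 2) ω * ind (U 3) ω) := by
    intro ω
    by_cases h0 : ω ∈ U 0 <;> by_cases h1 : ω ∈ U 1 <;> by_cases h2 : ω ∈ U 2 <;> by_cases h3 : ω ∈ U 3 <;>
      simp [ind_of_mem, ind_of_not_mem, h0, h1, h2, h3]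
    norm_num
  have h0 := (combPos_ex (ι := ι) (h := fun ω => 1 - (ind (U 1) ω * ind (U 2) ω * ind (U 3) ω + ind (U 0) ω * ind (U 2) ω * ind (U 3) ω
      + ind (U 0) ω * ind (U 1) ω * ind (U 3) ω + ind (U 0) ω * ind (U 1) ω * ind (U 2) ω)
      + 3 * (ind (U 0) ω * ind (U 1) ω * ind (U 2) ω * ind (U 3) ω)) hnn).of_ignores e
    fun p s => SahiCombDisjunct.ex_update_of_ignores' e (fun ω => by
      show 1 - (ind (U 1) (insert e ω) * ind (U 2) (insert e ω) * ind (U 3) (insert e ω) + ind (U 0) (insert e ω) * ind (U 2) (insert e ω) * ind (U 3) (insert e ω)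
          + ind (U 0) (insert e ω) * ind (U 1) (insert e ω) * ind (U 3) (insert e ω) + ind (U 0) (insert e ω) * ind (U 1) (insert e ω) * ind (U 2) (insert e ω))
          + 3 * (ind (U 0) (insert e ω) * ind (U 1) (insert e ω) * ind (U 2) (insert e ω) * ind (U 3) (insert e ω))
        = 1 - (ind (U 1) ω * ind (U 2) ω * ind (U 3) ω + ind (U 0) ω * ind (U 2) ω * ind (U 3) ω + ind (U 0) ω * ind (U 1) ω * ind (U 3) ω
          + ind (U 0) ω * ind (U 1) ω * ind (U 2) ω) + 3 * (ind (U 0) ω * ind (U 1) ω * ind (U 2) ω * ind (U 3) ω)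
      rw [ind_U4_insert U e hUe, ind_U4_insert U e hUe, ind_U4_insert U e hUe, ind_U4_insert U e hUe]) p s
  refine h0.congr fun p => ?_
  have ee := SahiMixture.ex_eq_lin (bernoulliWeight p) (fun ω => 1 - (ind (U 1) ω * ind (U 2) ω * ind (U 3) ω + ind (U 0) ω * ind (U 2) ω * ind (U 3) ω
      + ind (U 0) ω * ind (U 1) ω * ind (U 3) ω + ind (U 0) ω * ind (U 1) ω * ind (U 2) ω) + 3 * (ind (U 0) ω * ind (U 1) ω * ind (U 2) ω * ind (U 3) ω))
    ![1, -1, -1, -1, -1, 3] ![fun _ => 1, ind (U 1) * ind (U 2) * ind (U 3), ind (U 0) * ind (U 2) * ind (U 3), ind (U 0) * ind (U 1) * ind (U 3),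
      ind (U 0) * ind (U 1) * ind (U 2), ind (U 0) * ind (U 1) * ind (U 2) * ind (U 3)] (fun ω => by simp [Fin.sum_univ_succ]; ring)
  simp only [Fin.sum_univ_succ, Fin.sum_univ_zero, Matrix.cons_val_zero, Matrix.cons_val_succ, ex_const (sum_bernoulliWeight p)] at ee
  rw [ee]; ring

end Defects

/-- **The singleton four-slot cell with all four events mixed** (`G = (1,1,1,1)`, TOP(4) on the cube) is comb-positive at multidegree `4`. [this work] -/
theorem combPos_fourSlot_G4 (U : Fin 4 → Set (Set ι)) (e : ι) (hUe : ∀ (j : Fin 4) (b : Bool), secAt e b (U j) = U j) (hU : CombHereditary U) :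
    CombPos (fun _ : ι => 4) (fun p => sahiE (bernoulliWeight p) 4 (fun j => ind (orCoord U e (![true, true, true, true] : Fin 4 → Bool) j))) := by
  set Q : Fin 4 → Set (Set ι) := ![Set.univ, Set.univ, Set.univ, Set.univ] with hQdef
  have eS : (fun j => ind (orCoord U e (![true, true, true, true] : Fin 4 → Bool) j)) = fun j => ind (mixCoord e (U j) (Q j)) := by
    funext j; fin_cases j
    · exact congrArg ind (orCoord_eq_mixCoord_true U e _ 0 rfl)
    · exact congrArg ind (orCoord_eq_mixCoord_true U e _ 1 rfl)
    · exact congrArg ind (orCoord_eq_mixCoord_true U e _ 2 rfl)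
    · exact congrArg ind (orCoord_eq_mixCoord_true U e _ 3 rfl)
  have hQ : ∀ (j : Fin 4) (b : Bool), secAt e b (Q j) = Q j := by
    intro j b; fin_cases j <;> exact secAt_univ' e b
  have hPQ : ∀ j : Fin 4, U j ⊆ Q j := by
    intro j; fin_cases j <;> exact Set.subset_univ _
  -- the hereditary comb row E_4(U) in moment form
  have eU : (fun j => ind (⋂ i ∈ (![({0} : Finset (Fin 4)), {1}, {2}, {3}] : Fin 4 → Finset (Fin 4)) j, U i))
      = ![ind (U 0), ind (U 1), ind (U 2), ind (U 3)] := by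
    funext j; fin_cases j <;> simp
  have r4 := hU.row_off e hUe 4 ![({0} : Finset (Fin 4)), {1}, {2}, {3}]
  rw [eU] at r4
  have r4m := r4
  simp only [sahiE_four] at r4m
  -- the defect pieces, all lifted to multidegree 4 off e
  have d14 := deg_off_mono (ι := ι) e (show 1 ≤ 4 by norm_num)
  have d34 := deg_off_mono (ι := ι) e (show 3 ≤ 4 by norm_num)
  have T := (combPos_atMostTwo U e hUe).mono d14
  have c0 := combPos_co U e hUe 0
  have c1 := combPos_co U e hUe 1
  have c2 := combPos_co U e hUe 2
  have c3 := combPos_co U e hUe 3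
  have N4 := (combPos_mono2 e c0 c1).mul_of_eq (combPos_mono2 e c2 c3) (deg22 e)
  -- N₃ pieces: ½Σ_l Π_{r≠l}(1−m_r)
  have a0 := (combPos_mono3 e c1 c2 c3).mono d34
  have a1 := (combPos_mono3 e c0 c2 c3).mono d34
  have a2 := (combPos_mono3 e c0 c1 c3).mono d34
  have a3 := (combPos_mono3 e c0 c1 c2).mono d34
  -- ½Σ_{i≠l} (m_i − m_il) Π_{r∉{i,l}} (1 − m_r), products sorted
  have b01 := (combPos_mono3 e (combPos_diff U e hUe 0 1) c2 c3).mono d34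
  have b10 := (combPos_mono3 e (combPos_diff' U e hUe 1 0) c2 c3).mono d34
  have b02 := (combPos_mono3 e (combPos_diff U e hUe 0 2) c1 c3).mono d34
  have b20 := (combPos_mono3 e (combPos_diff' U e hUe 2 0) c1 c3).mono d34
  have b03 := (combPos_mono3 e (combPos_diff U e hUe 0 3) c1 c2).mono d34
  have b30 := (combPos_mono3 e (combPos_diff' U e hUe 3 0) c1 c2).mono d34
  have b12 := (combPos_mono3 e (combPos_diff U e hUe 1 2) c0 c3).mono d34
  have b21 := (combPos_mono3 e (combPos_diff' U e hUe 2 1) c0 c3).mono d34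
  have b13 := (combPos_mono3 e (combPos_diff U e hUe 1 3) c0 c2).mono d34
  have b31 := (combPos_mono3 e (combPos_diff' U e hUe 3 1) c0 c2).mono d34
  have b23 := (combPos_mono3 e (combPos_diff U e hUe 2 3) c0 c1).mono d34
  have b32 := (combPos_mono3 e (combPos_diff' U e hUe 3 2) c0 c1).mono d34
  have N3 := (((((a0.add a1).add (a2.add a3)).add ((b01.add b10).add (b02.add b20))).add (((b03.add b30).add (b12.add b21)))).add
    (((b13.add b31).add (b23.add b32)))).smul (by norm_num : (0:ℝ) ≤ 1 / 2)
  have q0 : ind (Q 0) = 1 := by simp [hQdef, ind_univ_eq_one]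
  have q1 : ind (Q 1) = 1 := by simp [hQdef, ind_univ_eq_one]
  have q2 : ind (Q 2) = 1 := by simp [hQdef, ind_univ_eq_one]
  have q3 : ind (Q 3) = 1 := by simp [hQdef, ind_univ_eq_one]
  have eP : (fun j => ind (U j)) = ![ind (U 0), ind (U 1), ind (U 2), ind (U 3)] := by funext j; fin_cases j <;> rfl
  have eQ : (fun j => ind (Q j)) = ![1, 1, 1, 1] := by
    funext j; fin_cases j <;> simp [hQdef, ind_univ_eq_one]
  rw [eS]
  refine combPos_four_mixCoord_of_coeffs e U Q hUe hQ hPQ ?_ ?_ ?_ ?_ ?_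
  · rw [eP]; exact r4
  · -- c₁ = T₁ + 2E₄ + N₃ + 2N₄
    refine ((((T.smul (by norm_num : (0:ℝ) ≤ 2)).add (r4m.smul (by norm_num : (0:ℝ) ≤ 2))).add N3).add (N4.smul (by norm_num : (0:ℝ) ≤ 2))).congr
      fun p => ?_
    simp only [mix4C1, q0, q1, q2, q3, mul_one, ex_one (sum_bernoulliWeight p)]
    ring
  · -- c₂ = 2T₁ + E₄ + N₃ + N₄
    refine ((((T.smul (by norm_num : (0:ℝ) ≤ 4)).add r4m).add N3).add N4).congr fun p => ?_
    simp only [mix4C2, q0, q1, q2, q3, mul_one, ex_one (sum_bernoulliWeight p)]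
    ring
  · -- c₃ = T₁
    refine (T.smul (by norm_num : (0:ℝ) ≤ 2)).congr fun p => ?_
    simp only [mix4C3, q0, q1, q2, q3, mul_one, ex_one (sum_bernoulliWeight p)]
    ring
  · -- c₄ = E₄(Ω,Ω,Ω,Ω) = 0
    refine (CombPos.zero _).congr fun p => ?_
    rw [eQ, sahiE_four]
    simp only [one_mul, ex_one (sum_bernoulliWeight p)]
    ring

end SahiCombMix

end Summit.CriticalPhenomena.PercolationContinuityZ3.Theorems

end
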